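import Mathlib
import Summits.NavierStokesRegularity.NavierStokesRegularity.Theorems.L3TimeExponentPincerEnergyLineAllP
import HarnessLib.Audit
import HarnessLib

/-!
# L3TimeExponentPincer — the Leray–Hopf mixed-norm scale IS the set of uniform bounds:
# `QuantBound p q ↔ 2/q + 3/p ≥ 3/2` for every `3 < p < 6`

Support kernel for the crux `L3CascadeJaw` (item stmt-NavierStokesRegularity-19499); sequel of
`…EnergyLineAllP` (negative side above the energy line, every `p > 3`) and `…EnergyLineSixTop`
(positive side at `p = 6`: `∫₀ᵀ‖u‖₆² ≤ K² E(u₀)/ν`).  The positive side is extended to the whole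
energy line `2/q + 3/p = 3/2`, `2 < p < 6`, by interpolating `L^p` between `L²` (energy) and `L⁶`
(Sobolev): with `q₀(p) = 4p/(3(p-2))` and `γ(p) = (6-p)/(3(p-2))`,

* `lintegral_rpow_le_interp_two_six` — `∫F^p ≤ (∫F²)^{(6-p)/4} (∫F⁶)^{(p-2)/4}` (Hölder);
* `eLpNorm_rpow_energyLine_le` — `‖w‖_p^{q₀} ≤ (∫|w|²)^{γ} ‖w‖₆²`;
* `lpTime_energyLine_le` — `∫₀ᵀ‖u‖_p^{q₀} ≤ E₀^{γ} · K² E(u₀)/ν` for every frame solution;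
* `quantBound_energyLine : QuantBound (ofReal p) q₀`, `quantBound_below_energyLine` (`0 ≤ q ≤ q₀`);
* `quantBound_iff_energyLine : 3 < p < 6 → 0 < q → (QuantBound (ofReal p) q ↔ q ≤ q₀(p))` —
  together with `quantJaw_iff` (`p = 3`), `quantBound_six_iff` (`p = 6`) and `not_quantBound_top`
  (`p = ∞`): **a uniform `(E₀, ν, T)`-bound on `∫₀ᵀ‖u‖_p^q` over Schwartz data exists exactly on and
  below the energy line** — the viscous rings saturate the Leray–Hopf scale.

WHAT THIS IS NOT: not NS regularity or blow-up; the crux `L3CascadeJaw` is untouched; no crux claim.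
-/

noncomputable section

namespace Summit.NavierStokesRegularity.NavierStokesRegularity.Theorems.L3TimeExponentPincerEnergyLineScale

open MeasureTheory Set Filter Literature.Analysis.FluidPDE
open Summit.NavierStokesRegularity.NavierStokesRegularity.Theorems.L3TimeExponentPincerQuantJaw
open Summit.NavierStokesRegularity.NavierStokesRegularity.Theorems.L3TimeExponentPincerJawEnergyFloor
open Summit.NavierStokesRegularity.NavierStokesRegularity.Theorems.L3TimeExponentPincerCritModulus
open Summit.NavierStokesRegularity.NavierStokesRegularity.Theorems.L3TimeExponentPincerQuantJawEnergyLine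
open Summit.NavierStokesRegularity.NavierStokesRegularity.Theorems.L3TimeExponentPincerEnergyLineSixTop
open Summit.NavierStokesRegularity.NavierStokesRegularity.Theorems.L3TimeExponentPincerEnergyLineAllP
open scoped ENNReal NNReal

/-! ### A. Interpolation of `L^p` between `L²` and `L⁶` -/

/-- **`∫ F^p ≤ (∫ F²)^{(6-p)/4} · (∫ F⁶)^{(p-2)/4}`** for `2 < p < 6` (Hölder with exponents
`4/(6-p)`, `4/(p-2)` applied to `F^{(6-p)/2} · F^{3(p-2)/2}`). -/
theorem lintegral_rpow_le_interp_two_six {α : Type*} [MeasurableSpace α] (μ : Measure α)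
    {F : α → ℝ≥0∞} (hF : AEMeasurable F μ) {p : ℝ} (hp2 : 2 < p) (hp6 : p < 6) :
    ∫⁻ x, F x ^ p ∂μ ≤
      (∫⁻ x, F x ^ (2 : ℝ) ∂μ) ^ ((6 - p) / 4) * (∫⁻ x, F x ^ (6 : ℝ) ∂μ) ^ ((p - 2) / 4) := by
  have h1 : 0 < 6 - p := by linarith
  have h2 : 0 < p - 2 := by linarith
  have hr : (4 / (6 - p)).HolderConjugate (4 / (p - 2)) := by
    refine Real.holderConjugate_iff.2 ⟨(one_lt_div h1).2 (by linarith), ?_⟩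
    rw [inv_div, inv_div]
    field_simp
    ring
  set a : ℝ := (6 - p) / 2 with ha
  have ha0 : 0 ≤ a := by positivity
  have hpa : 0 ≤ p - a := by rw [ha]; linarith
  have key := ENNReal.lintegral_mul_le_Lp_mul_Lq μ hr (hF.pow_const a) (hF.pow_const (p - a))
  have elhs : (fun x => F x ^ a * F x ^ (p - a)) = fun x => F x ^ p := by
    funext x
    rw [← ENNReal.rpow_add_of_nonneg _ _ ha0 hpa]
    congr 1; ring
  have e1 : ∀ x, (F x ^ a) ^ (4 / (6 - p)) = F x ^ (2 : ℝ) := fun x => by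
    rw [← ENNReal.rpow_mul]
    congr 1
    rw [ha]; field_simp; try ring
  have e2 : ∀ x, (F x ^ (p - a)) ^ (4 / (p - 2)) = F x ^ (6 : ℝ) := fun x => by
    rw [← ENNReal.rpow_mul]
    congr 1
    rw [ha]; field_simp; try ring
  have e3 : 1 / (4 / (6 - p)) = (6 - p) / 4 := by rw [one_div, inv_div]
  have e4 : 1 / (4 / (p - 2)) = (p - 2) / 4 := by rw [one_div, inv_div]
  simp only [Pi.mul_apply, e1, e2, e3, e4] at key
  rw [elhs] at key
  exact key

/-- **Slice bound on the energy line**: for `2 < p < 6` and an a.e.-strongly measurable field `w`,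
`‖w‖_p^{4p/(3(p-2))} ≤ (∫|w|²)^{(6-p)/(3(p-2))} · ‖w‖₆²`. -/
theorem eLpNorm_rpow_energyLine_le {p : ℝ} (hp2 : 2 < p) (hp6 : p < 6) {w : E3 → E3}
    (hw : AEStronglyMeasurable w volume) :
    eLpNorm w (ENNReal.ofReal p) volume ^ (4 * p / (3 * (p - 2))) ≤
      (∫⁻ x, ‖w x‖ₑ ^ 2) ^ ((6 - p) / (3 * (p - 2))) * eLpNorm w 6 volume ^ (2 : ℝ) := by
  have hp0 : 0 < p := by linarith
  have h2 : 0 < p - 2 := by linarith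
  have h3 : 0 < 3 * (p - 2) := by linarith
  have hI := lintegral_rpow_le_interp_two_six volume hw.enorm hp2 hp6
  have ep : (∫⁻ x, ‖w x‖ₑ ^ p) = eLpNorm w (ENNReal.ofReal p) volume ^ p :=
    (eLpNorm_rpow_eq_lintegral volume w hp0).symm
  have e6 : (∫⁻ x, ‖w x‖ₑ ^ (6 : ℝ)) = eLpNorm w 6 volume ^ (6 : ℝ) := by
    have h := eLpNorm_rpow_eq_lintegral volume w (p := 6) (by norm_num)
    rw [show ENNReal.ofReal (6 : ℝ) = 6 by norm_num] at h
    exact h.symm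
  have e2 : (∫⁻ x, ‖w x‖ₑ ^ (2 : ℝ)) = ∫⁻ x, ‖w x‖ₑ ^ 2 :=
    lintegral_congr fun x => by rw [show (2 : ℝ) = ((2 : ℕ) : ℝ) by norm_num, ENNReal.rpow_natCast]
  have epq : eLpNorm w (ENNReal.ofReal p) volume ^ (4 * p / (3 * (p - 2))) =
      (∫⁻ x, ‖w x‖ₑ ^ p) ^ (4 / (3 * (p - 2))) := by
    rw [ep, ← ENNReal.rpow_mul]
    congr 1
    field_simp
  rw [epq]
  calc (∫⁻ x, ‖w x‖ₑ ^ p) ^ (4 / (3 * (p - 2)))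
      ≤ ((∫⁻ x, ‖w x‖ₑ ^ (2 : ℝ)) ^ ((6 - p) / 4) * (∫⁻ x, ‖w x‖ₑ ^ (6 : ℝ)) ^ ((p - 2) / 4)) ^
          (4 / (3 * (p - 2))) := ENNReal.rpow_le_rpow hI (by positivity)
    _ = (∫⁻ x, ‖w x‖ₑ ^ (2 : ℝ)) ^ ((6 - p) / (3 * (p - 2))) *
          (∫⁻ x, ‖w x‖ₑ ^ (6 : ℝ)) ^ ((1 : ℝ) / 3) := by
        rw [ENNReal.mul_rpow_of_nonneg _ _ (by positivity), ← ENNReal.rpow_mul, ← ENNReal.rpow_mul]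
        congr 2
        · field_simp
        · field_simp
    _ = (∫⁻ x, ‖w x‖ₑ ^ 2) ^ ((6 - p) / (3 * (p - 2))) * eLpNorm w 6 volume ^ (2 : ℝ) := by
        rw [e2, e6, ← ENNReal.rpow_mul]
        norm_num

/-! ### B. The integrated bound and `QuantBound` on the energy line -/

/-- **`∫₀ᵀ ‖u‖_p^{q₀(p)} ≤ E₀^{γ(p)} · K² · E(u₀)/ν`** for every frame solution (`2 < p < 6`,
`q₀ = 4p/(3(p-2))`, `γ = (6-p)/(3(p-2))`, `E₀ = ∫|u₀|²`). -/
theorem lpTime_energyLine_le {p : ℝ} (hp2 : 2 < p) (hp6 : p < 6) {ν T : ℝ} (hν : 0 < ν) (hT : 0 < T)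
    {u : ℝ → E3 → E3} {pr : ℝ → E3 → ℝ} (hF : IsFrameSolution ν T u pr) :
    lpTime (ENNReal.ofReal p) (4 * p / (3 * (p - 2))) T u ≤
      energy0 u ^ ((6 - p) / (3 * (p - 2))) *
        (((SNormLESNormFDerivOfEqConst (EuclideanSpace ℝ (Fin 3))
            (volume : Measure (EuclideanSpace ℝ (Fin 3))) 2 : ℝ≥0) : ℝ≥0∞) ^ 2 *
          ENNReal.ofReal (VectorCalculus.kineticEnergy (u 0) / ν)) := by
  have hγ : 0 ≤ (6 - p) / (3 * (p - 2)) := div_nonneg (by linarith) (by linarith)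
  have hE0eq : energy0 u = ENNReal.ofReal (2 * VectorCalculus.kineticEnergy (u 0)) := by
    have := hF.lerayHopf.eEnergy_eq (t := 0) ⟨le_rfl, hT.le⟩
    rwa [eEnergy] at this
  have hen : ∀ t ∈ Ioo 0 T, ∫⁻ x, ‖u t x‖ₑ ^ 2 ≤ energy0 u := by
    intro t ht
    rw [hE0eq]
    exact hF.lerayHopf.lintegral_enorm_sq_le hν.le ⟨ht.1.le, ht.2.le⟩
  have hE0fin : energy0 u < ⊤ := energy0_lt_top_of_hasRapidSpatialDecay hF.decay
  have hcst : energy0 u ^ ((6 - p) / (3 * (p - 2))) ≠ ⊤ :=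
    ENNReal.rpow_ne_top_of_nonneg hγ hE0fin.ne
  calc lpTime (ENNReal.ofReal p) (4 * p / (3 * (p - 2))) T u
      = ∫⁻ t in Ioo 0 T, eLpNorm (u t) (ENNReal.ofReal p) volume ^ (4 * p / (3 * (p - 2))) := rfl
    _ ≤ ∫⁻ t in Ioo 0 T, energy0 u ^ ((6 - p) / (3 * (p - 2))) * eLpNorm (u t) 6 volume ^ (2 : ℝ) := by
        refine setLIntegral_mono' measurableSet_Ioo fun t ht => ?_
        calc eLpNorm (u t) (ENNReal.ofReal p) volume ^ (4 * p / (3 * (p - 2)))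
            ≤ (∫⁻ x, ‖u t x‖ₑ ^ 2) ^ ((6 - p) / (3 * (p - 2))) * eLpNorm (u t) 6 volume ^ (2 : ℝ) :=
              eLpNorm_rpow_energyLine_le hp2 hp6 (frame_aestronglyMeasurable hF ht)
          _ ≤ energy0 u ^ ((6 - p) / (3 * (p - 2))) * eLpNorm (u t) 6 volume ^ (2 : ℝ) := by
              gcongr
              exact hen t ht
    _ = energy0 u ^ ((6 - p) / (3 * (p - 2))) * lpTime 6 2 T u := lintegral_const_mul' _ _ hcst
    _ ≤ _ := mul_le_mul' le_rfl (lpTime_six_two_le hν hT hF)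

/-- **`QuantBound (ofReal p) (4p/(3(p-2)))`: the uniform bound ON the energy line**, `2 < p < 6`. -/
theorem quantBound_energyLine {p : ℝ} (hp2 : 2 < p) (hp6 : p < 6) :
    QuantBound (ENNReal.ofReal p) (4 * p / (3 * (p - 2))) := by
  intro ν T E hν hT hE
  have hγ : 0 ≤ (6 - p) / (3 * (p - 2)) := div_nonneg (by linarith) (by linarith)
  set K : ℝ≥0 := SNormLESNormFDerivOfEqConst (EuclideanSpace ℝ (Fin 3))
    (volume : Measure (EuclideanSpace ℝ (Fin 3))) 2 with hK
  set B : ℝ≥0∞ := ENNReal.ofReal E ^ ((6 - p) / (3 * (p - 2))) *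
    ((K : ℝ≥0∞) ^ 2 * ENNReal.ofReal (E / (2 * ν))) with hB
  have hBt : B ≠ ⊤ := ENNReal.mul_ne_top (ENNReal.rpow_ne_top_of_nonneg hγ ENNReal.ofReal_ne_top)
    (ENNReal.mul_ne_top (ENNReal.pow_ne_top ENNReal.coe_ne_top) ENNReal.ofReal_ne_top)
  refine ⟨B.toNNReal, fun u pr hF hEu => ?_⟩
  rw [ENNReal.coe_toNNReal hBt]
  have hE0eq : energy0 u = ENNReal.ofReal (2 * VectorCalculus.kineticEnergy (u 0)) := by
    have := hF.lerayHopf.eEnergy_eq (t := 0) ⟨le_rfl, hT.le⟩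
    rwa [eEnergy] at this
  have hkin : VectorCalculus.kineticEnergy (u 0) / ν ≤ E / (2 * ν) := by
    have h2 : 2 * VectorCalculus.kineticEnergy (u 0) ≤ E := by
      rw [hE0eq] at hEu
      exact (ENNReal.ofReal_le_ofReal_iff hE).1 hEu
    rw [div_le_div_iff₀ hν (by positivity)]
    nlinarith
  calc lpTime (ENNReal.ofReal p) (4 * p / (3 * (p - 2))) T u
      ≤ energy0 u ^ ((6 - p) / (3 * (p - 2))) *
          ((K : ℝ≥0∞) ^ 2 * ENNReal.ofReal (VectorCalculus.kineticEnergy (u 0) / ν)) :=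
        lpTime_energyLine_le hp2 hp6 hν hT hF
    _ ≤ ENNReal.ofReal E ^ ((6 - p) / (3 * (p - 2))) *
          ((K : ℝ≥0∞) ^ 2 * ENNReal.ofReal (E / (2 * ν))) := by
        gcongr
    _ = B := rfl

/-- `x^q ≤ 1 + x^r` in `ℝ≥0∞` for `0 ≤ q ≤ r`. -/
theorem rpow_le_one_add_rpow {x : ℝ≥0∞} {q r : ℝ} (hq0 : 0 ≤ q) (hqr : q ≤ r) :
    x ^ q ≤ 1 + x ^ r := by
  rcases le_total x 1 with h | h
  · exact (ENNReal.rpow_le_one h hq0).trans le_self_add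
  · exact (ENNReal.rpow_le_rpow_of_exponent_le h hqr).trans le_add_self

/-- **`QuantBound (ofReal p) q` below the energy line**: `2 < p < 6`, `0 ≤ q ≤ 4p/(3(p-2))`. -/
theorem quantBound_below_energyLine {p q : ℝ} (hp2 : 2 < p) (hp6 : p < 6) (hq0 : 0 ≤ q)
    (hq : q ≤ 4 * p / (3 * (p - 2))) : QuantBound (ENNReal.ofReal p) q := by
  intro ν T E hν hT hE
  obtain ⟨B, hB⟩ := quantBound_energyLine hp2 hp6 ν T E hν hT hE
  refine ⟨(ENNReal.ofReal T).toNNReal + B, fun u pr hF hEu => ?_⟩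
  have h0 := hB u pr hF hEu
  calc lpTime (ENNReal.ofReal p) q T u
      = ∫⁻ t in Ioo 0 T, eLpNorm (u t) (ENNReal.ofReal p) volume ^ q := rfl
    _ ≤ ∫⁻ t in Ioo 0 T, ((fun _ => (1 : ℝ≥0∞)) t +
          eLpNorm (u t) (ENNReal.ofReal p) volume ^ (4 * p / (3 * (p - 2)))) :=
        lintegral_mono fun t => rpow_le_one_add_rpow hq0 hq
    _ = (∫⁻ _ in Ioo 0 T, (1 : ℝ≥0∞)) +
          ∫⁻ t in Ioo 0 T, eLpNorm (u t) (ENNReal.ofReal p) volume ^ (4 * p / (3 * (p - 2))) :=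
        lintegral_add_left measurable_const _
    _ ≤ ENNReal.ofReal T + (B : ℝ≥0∞) := by
        gcongr
        · rw [setLIntegral_const, Real.volume_Ioo, sub_zero, one_mul]
        · exact h0
    _ = (((ENNReal.ofReal T).toNNReal + B : ℝ≥0) : ℝ≥0∞) := by
        rw [ENNReal.coe_add, ENNReal.coe_toNNReal ENNReal.ofReal_ne_top]

/-! ### C. The dichotomy on `3 < p < 6` -/

/-- **The Leray–Hopf scale is exactly the set of uniform bounds** (`3 < p < 6`): for `q > 0`,
`QuantBound (ofReal p) q ↔ q ≤ 4p/(3(p-2))`, i.e. `↔ 2/q + 3/p ≥ 3/2` (`⇐`: energy × Sobolev ×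
dissipation; `⇒`: the viscous rings, `not_quantBound_of_three_lt`). -/
theorem quantBound_iff_energyLine {p q : ℝ} (hp3 : 3 < p) (hp6 : p < 6) (hq : 0 < q) :
    QuantBound (ENNReal.ofReal p) q ↔ q ≤ 4 * p / (3 * (p - 2)) := by
  have hp0 : 0 < p := by linarith
  have h3 : 0 < 3 * (p - 2) := by linarith
  refine ⟨fun h => le_of_not_gt fun hgt => ?_, quantBound_below_energyLine (by linarith) hp6 hq.le⟩
  -- above the line: `2/q + 3/p < 3/2`
  have hq0pos : 0 < 4 * p / (3 * (p - 2)) := by positivity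
  have h1 : 2 / q < 2 / (4 * p / (3 * (p - 2))) := div_lt_div_of_pos_left two_pos hq0pos hgt
  have h2 : 2 / (4 * p / (3 * (p - 2))) + 3 / p = 3 / 2 := by
    field_simp
    ring
  exact not_quantBound_of_three_lt hp3 hq (by linarith) h

/--
info: 'Summit.NavierStokesRegularity.NavierStokesRegularity.Theorems.L3TimeExponentPincerEnergyLineScale.quantBound_iff_energyLine' depends on axioms: [propext,
 Classical.choice,
 Quot.sound]
-/
#guard_msgs in
#print axioms quantBound_iff_energyLine

end Summit.NavierStokesRegularity.NavierStokesRegularity.Theorems.L3TimeExponentPincerEnergyLineScale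

end
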